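import Mathlib
import HarnessLib
import Summits.HubbardSuperconductivity.HubbardSuperconductivity.Theorems.KLProgrammeC4aAbsBubbleNonCooper
import Summits.HubbardSuperconductivity.HubbardSuperconductivity.Theorems.KLProgrammeC4aAbsBubbleDirectSheet

/-!
# Route `KLProgramme` — crux C4a, S3 brick (B4) «(B4)-K0-NEG-LEVELS» part 1: the `k = 0` level-loop counts of B4-DIRECT-PACK for NEGATIVE loop levels —
# the relative second-order dichotomy for `|e| ≤ hi` (both signs) and the non-Cooper / Cooper-chord level-loop bounds for the reflected level family `e ↦ Φ(−e,·)`

Cell `gate-hubbard-kl`, seat hubbard-kl-k3c3-p3 (g36; row «implicit-function / monotonicity route for μ(n)»).  Located brick for the (C)-closer lane / the (M4)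
assembly of the ϑ-layers (stub (C) `stub_twoLeg_curvature` of `KLRegimeEngineV17F2`, stmt-HubbardSuperconductivity-20437), memo
HOME/hubbard-kl-k3c3-p3/U1-CAUSTIC-SUP.md §19 («(B4)-K0-NEG-LEVELS», located g36).

WHY.  The `k = 0` dominator of B4-DIRECT-PACK (`…C4aAbsBubbleDominator.absBubble_partnerBand_le_posLog`, p654882) and its two level-loop inputs
(`level_loop_partnerBand_le_nonCooper` p652943, `level_loop_partnerBand_le_cooper_chord` p651940) integrate the loop level over `e ∈ [lo, hi]`, `0 < lo` — POSITIVE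
levels only; the co-moving tube carries levels of both signs (`e ∈ (−r, r)`), and both the `M₀` row of `CoMovingJetsL1Theta` and the direct parts of the first-order layer
(«(U1)-HYBRID» D-2) need the negative half.  Inspection of the proofs shows the positivity of `e` is used ONLY to read `|e|` as `e` (tube membership `|e| < r, r₀`, the level gap
`|ē| ≤ |ē − e| + |e|`); the geometry (chart points on every sheet, `loopAlignment_dichotomy_sheet`, the fold floor `iteratedDeriv_two_partnerBand_pp_angle_ge_sheet`) is stated
for `|e| < r`.  Hence:
* **`rel_dichotomy_two_partnerBand_abs`** — p652943's dichotomy with `|e| ≤ hi` (both signs), proof verbatim up to that reading;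
* **`level_loop_partnerBand_le_nonCooper_neg`** — the non-Cooper level-loop count for the REFLECTED family: `∫_{lo}^{hi} w(s)·∫ (max (t s) |e_K(S − Φ(−s, x+θ))|)⁻¹ dx ds`
  obeys p652943's bound VERBATIM (abstract layer `level_loop_inv_envelope_le_of_rel_dichotomy_two` applied to `G s x := −e_K(S − Φ(−s,x+θ))`, whose near-nesting gap
  `|G s x − s| = |ē − (−s)|` is the dichotomy's at level `−s`);
* **`level_loop_partnerBand_le_cooper_chord_neg`** — the Cooper-chord class likewise (p651940's bound verbatim; abstract layer `level_loop_inv_envelope_le_cooper`).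
The negative-level DOMINATOR (p654882's twin: dispatch on the chord, `posLog` conversion) is then the same 30-line composition (part 2).
Sizes binder shape + `GeomConstants`; nothing asserts (C), K3 or superconductivity.
References: FST II CPAM 51 (1998) §3 [cite: FeldmanSalmhoferTrubowitz1998]; BGM 2003 §7.1 Lemma 7.1 [cite: BenfattoGiulianiMastropietro2003]; BGM 2006 §2.4 [cite: BenfattoGiulianiMastropietro2006].
-/


noncomputable section

namespace Summit.HubbardSuperconductivity.HubbardSuperconductivity.Theorems.C4a

set_option linter.dupNamespace false -- summit = problem name (single-conjunct summit), D-0017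

open Real Set MeasureTheory
open Literature.MathematicalPhysics.QuantumLattice Literature.MathematicalPhysics.QuantumLattice.BandSectorCounting
open Literature.MathematicalPhysics.QuantumLattice.FermiRG
open Summit.HubbardSuperconductivity.HubbardSuperconductivity.Theorems.KLRegimeSplit
open Summit.HubbardSuperconductivity.HubbardSuperconductivity.Theorems.DispersionFlow
open Summit.HubbardSuperconductivity.HubbardSuperconductivity.Theorems.PerturbedFermiCurve

section Sizes

variable {K : TrigPolyC4v} {A : ℝ} (hA : ∀ p : Momentum, ∀ j ≤ 2, ‖iteratedFDeriv ℝ j (frameShift K) p‖ ≤ A) (hA20 : A ≤ 1 / 20)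
  (hd : klCurveD ≤ (bandBounds (show (-4 : ℝ) < -1.1 by norm_num) (show (-1.1 : ℝ) ≤ -0.1 by norm_num)
    (show (-0.1 : ℝ) < 0 by norm_num)).Dtmin - 2 * A)
  {μ r : ℝ} (hr : 0 < r) (hlo : (-1.1 : ℝ) < μ - r - A) (hhi : μ + r + A < -0.1)
  {A₃ A₄ : ℝ} (hA₃ : ∀ p : Momentum, ‖iteratedFDeriv ℝ 3 (frameShift K) p‖ ≤ A₃)
  (hA₄ : ∀ p : Momentum, ‖iteratedFDeriv ℝ 4 (frameShift K) p‖ ≤ A₄)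
  {K₁ K₂ K₃ : ℝ} (hK₁ : ∀ p : Momentum, ‖fderiv ℝ (frameLevel μ K) p‖ ≤ K₁) (hK₂ : ∀ p : Momentum, ‖iteratedFDeriv ℝ 2 (frameLevel μ K) p‖ ≤ K₂)
  (hK₃ : ∀ p : Momentum, ‖iteratedFDeriv ℝ 3 (frameLevel μ K) p‖ ≤ K₃)
include hA hA20 hd hr hlo hhi hA₃ hA₄ hK₁ hK₂ hK₃

omit hr in
/-- **THE RELATIVE SECOND-ORDER DICHOTOMY, POINTWISE, NO LOCATED DATUM — LEVELS OF BOTH SIGNS** (`|e| ≤ hi` in place of `0 < e ≤ hi`; proof verbatim from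
p652943's `rel_dichotomy_two_partnerBand`, whose positivity of the level was used only to read `|e|` as `e`).  `GeomConstants (frameLevel μ K) Kc r₀ g₀ w`; configuration `(ρ,ϑ,θ)` with pair sum `S`
not `(c₁,κ)`-Cooper relative to any sheet (`hC`: `msD₁τ(c₁,κ) + κ/(Dt−2A) < ‖S − 2πm‖` for all `m`; part 2 discharges `m ≠ 0`); loop level `|e| ≤ hi` with
`hi < r₀`, `hi + κ < r`; the smallness `hsmall`: p623173's modulus at (`δ_T = msD₁τ(c₁,κ) + (2hi+κ)/(Dt−2A)`, `hi`, offset `0`) is `≤ w·u_min²`.  THEN at every loop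
angle `x`: `|ē − e| ≤ κ → |∂ₓē| < c₁ → w·u_min² ≤ ∂ₓ²ē`. [cite: FeldmanSalmhoferTrubowitz1998, §3; Salmhofer1999, §4.5.3 Lemma 4.10] -/
theorem rel_dichotomy_two_partnerBand_abs {Kc r₀ g₀ w : ℝ} (hG : GeomConstants (frameLevel μ K) Kc r₀ g₀ w) {ρ ϑ θ e hi κ c₁ : ℝ}
    (hehi : |e| ≤ hi) (hhir₀ : hi < r₀) (hhir : hi + κ < r) (hκ : 0 ≤ κ)
    (hC : ∀ m : Fin 2 → ℤ, msD A₃ A₄ 1 *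
            ((π / 2 * c₁ /
                  (((bandBounds (show (-4 : ℝ) < -1.1 by norm_num) (show (-1.1 : ℝ) ≤ -0.1 by norm_num) (show (-0.1 : ℝ) < 0 by norm_num)).Dtmin -
                      2 * A) *
                    (bandBounds (show (-4 : ℝ) < -1.1 by norm_num) (show (-1.1 : ℝ) ≤ -0.1 by norm_num) (show (-0.1 : ℝ) < 0 by norm_num)).umin) +
                π * Kc * κ / ((bandBounds (show (-4 : ℝ) < -1.1 by norm_num) (show (-1.1 : ℝ) ≤ -0.1 by norm_num)
                  (show (-0.1 : ℝ) < 0 by norm_num)).Dtmin - 2 * A) ^ 2) /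
              ((bandBounds (show (-4 : ℝ) < -1.1 by norm_num) (show (-1.1 : ℝ) ≤ -0.1 by norm_num) (show (-0.1 : ℝ) < 0 by norm_num)).umin * w /
                (4 + 2 * A))) +
          κ / ((bandBounds (show (-4 : ℝ) < -1.1 by norm_num) (show (-1.1 : ℝ) ≤ -0.1 by norm_num) (show (-0.1 : ℝ) < 0 by norm_num)).Dtmin - 2 * A) <
        ‖pairSumPath μ K ρ ϑ θ 0 - WithLp.toLp 2 (fun i => 2 * π * (m i : ℝ))‖)
    (hsmall :
        K₃ * ((msD A₃ A₄ 1 *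
            ((π / 2 * c₁ /
                  (((bandBounds (show (-4 : ℝ) < -1.1 by norm_num) (show (-1.1 : ℝ) ≤ -0.1 by norm_num) (show (-0.1 : ℝ) < 0 by norm_num)).Dtmin -
                      2 * A) *
                    (bandBounds (show (-4 : ℝ) < -1.1 by norm_num) (show (-1.1 : ℝ) ≤ -0.1 by norm_num) (show (-0.1 : ℝ) < 0 by norm_num)).umin) +
                π * Kc * κ / ((bandBounds (show (-4 : ℝ) < -1.1 by norm_num) (show (-1.1 : ℝ) ≤ -0.1 by norm_num)
                  (show (-0.1 : ℝ) < 0 by norm_num)).Dtmin - 2 * A) ^ 2) /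
              ((bandBounds (show (-4 : ℝ) < -1.1 by norm_num) (show (-1.1 : ℝ) ≤ -0.1 by norm_num) (show (-0.1 : ℝ) < 0 by norm_num)).umin * w /
                (4 + 2 * A)))) +
          (2 * hi + κ) / ((bandBounds (show (-4 : ℝ) < -1.1 by norm_num) (show (-1.1 : ℝ) ≤ -0.1 by norm_num) (show (-0.1 : ℝ) < 0 by norm_num)).Dtmin - 2 * A) +
              hi / ((bandBounds (show (-4 : ℝ) < -1.1 by norm_num) (show (-1.1 : ℝ) ≤ -0.1 by norm_num) (show (-0.1 : ℝ) < 0 by norm_num)).Dtmin - 2 * A)) *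
            msD A₃ A₄ 1 ^ 2 +
          K₂ * (radialRowOneConst A ((bandBounds (show (-4 : ℝ) < -1.1 by norm_num) (show (-1.1 : ℝ) ≤ -0.1 by norm_num) (show (-0.1 : ℝ) < 0 by norm_num)).Dtmin -
                2 * A) * hi) * (msD A₃ A₄ 1 + msD A₃ A₄ 1) +
          K₂ * ((msD A₃ A₄ 1 *
            ((π / 2 * c₁ /
                  (((bandBounds (show (-4 : ℝ) < -1.1 by norm_num) (show (-1.1 : ℝ) ≤ -0.1 by norm_num) (show (-0.1 : ℝ) < 0 by norm_num)).Dtmin -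
                      2 * A) *
                    (bandBounds (show (-4 : ℝ) < -1.1 by norm_num) (show (-1.1 : ℝ) ≤ -0.1 by norm_num) (show (-0.1 : ℝ) < 0 by norm_num)).umin) +
                π * Kc * κ / ((bandBounds (show (-4 : ℝ) < -1.1 by norm_num) (show (-1.1 : ℝ) ≤ -0.1 by norm_num)
                  (show (-0.1 : ℝ) < 0 by norm_num)).Dtmin - 2 * A) ^ 2) /
              ((bandBounds (show (-4 : ℝ) < -1.1 by norm_num) (show (-1.1 : ℝ) ≤ -0.1 by norm_num) (show (-0.1 : ℝ) < 0 by norm_num)).umin * w /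
                (4 + 2 * A)))) +
          (2 * hi + κ) / ((bandBounds (show (-4 : ℝ) < -1.1 by norm_num) (show (-1.1 : ℝ) ≤ -0.1 by norm_num) (show (-0.1 : ℝ) < 0 by norm_num)).Dtmin - 2 * A) +
              hi / ((bandBounds (show (-4 : ℝ) < -1.1 by norm_num) (show (-1.1 : ℝ) ≤ -0.1 by norm_num) (show (-0.1 : ℝ) < 0 by norm_num)).Dtmin - 2 * A)) *
            msD A₃ A₄ 2 +
          K₁ * ((uRowTwoConst A A₃ ((bandBounds (show (-4 : ℝ) < -1.1 by norm_num) (show (-1.1 : ℝ) ≤ -0.1 by norm_num) (show (-0.1 : ℝ) < 0 by norm_num)).Dtmin -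
                  2 * A) +
                1 / ((bandBounds (show (-4 : ℝ) < -1.1 by norm_num) (show (-1.1 : ℝ) ≤ -0.1 by norm_num) (show (-0.1 : ℝ) < 0 by norm_num)).Dtmin - 2 * A) +
                2 * (radialRowOneConst A ((bandBounds (show (-4 : ℝ) < -1.1 by norm_num) (show (-1.1 : ℝ) ≤ -0.1 by norm_num)
                    (show (-0.1 : ℝ) < 0 by norm_num)).Dtmin - 2 * A) -
                  1 / ((bandBounds (show (-4 : ℝ) < -1.1 by norm_num) (show (-1.1 : ℝ) ≤ -0.1 by norm_num) (show (-0.1 : ℝ) < 0 by norm_num)).Dtmin - 2 * A))) *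
              hi) ≤
        w * (bandBounds (show (-4 : ℝ) < -1.1 by norm_num) (show (-1.1 : ℝ) ≤ -0.1 by norm_num) (show (-0.1 : ℝ) < 0 by norm_num)).umin ^ 2)
    (x : ℝ) (hGe : |frameLevel μ K (pairSumPath μ K ρ ϑ θ 0 - levelPoint μ K e (x + θ)) - e| ≤ κ)
    (hslope : |deriv (fun y : ℝ => frameLevel μ K (pairSumPath μ K ρ ϑ θ 0 - levelPoint μ K e (y + θ))) x| < c₁) :
    w * (bandBounds (show (-4 : ℝ) < -1.1 by norm_num) (show (-1.1 : ℝ) ≤ -0.1 by norm_num) (show (-0.1 : ℝ) < 0 by norm_num)).umin ^ 2 ≤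
      iteratedDeriv 2 (fun y : ℝ => frameLevel μ K (pairSumPath μ K ρ ϑ θ 0 - levelPoint μ K e (y + θ))) x := by
  set B := bandBounds (show (-4 : ℝ) < -1.1 by norm_num) (show (-1.1 : ℝ) ≤ -0.1 by norm_num) (show (-0.1 : ℝ) < 0 by norm_num) with hBdef
  have hr' : 0 < r := by linarith [hκ, abs_nonneg e, hehi, hhir]
  have her : |e| < r := lt_of_le_of_lt hehi (by linarith)
  have her₀ : |e| < r₀ := lt_of_le_of_lt hehi hhir₀
  have hē : |frameLevel μ K (pairSumPath μ K ρ ϑ θ 0 - levelPoint μ K e (x + θ))| < r := by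
    have h1 := abs_sub_abs_le_abs_sub (frameLevel μ K (pairSumPath μ K ρ ϑ θ 0 - levelPoint μ K e (x + θ))) e
    have h2 : |frameLevel μ K (pairSumPath μ K ρ ϑ θ 0 - levelPoint μ K e (x + θ))| ≤ κ + |e| := by linarith [h1, hGe]
    linarith [h2, hehi, hhir]
  -- signs
  have hA0 : 0 ≤ A := (norm_nonneg _).trans (hA 0 0 (by norm_num))
  have hA₃0 : 0 ≤ A₃ := (norm_nonneg _).trans (hA₃ 0)
  have hDt : 0 < B.Dtmin - 2 * A := by have := klCurveD_pos; linarith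
  have hu : 0 < B.umin := B.umin_pos
  have hw : 0 < w := hG.wmin_pos
  have hcK : 0 < B.umin * w / (4 + 2 * A) := by positivity
  have hKc : 0 ≤ Kc := le_trans (norm_nonneg _) (hG.norm_iteratedFDeriv_le (0 : Momentum) 0 (by norm_num))
  have hM : 0 ≤ msD A₃ A₄ 1 := (norm_nonneg _).trans (norm_iteratedDeriv_levelPoint_le hA hA20 hd hlo hhi hA₃ hA₄ her le_rfl (by norm_num) 0)
  have hM2 : 0 ≤ msD A₃ A₄ 2 := (norm_nonneg _).trans (norm_iteratedDeriv_levelPoint_le hA hA20 hd hlo hhi hA₃ hA₄ her (i := 2) (by norm_num) (by norm_num) 0)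
  have hK₁0 : 0 ≤ K₁ := (norm_nonneg _).trans (hK₁ 0)
  have hK₂0 : 0 ≤ K₂ := (norm_nonneg _).trans (hK₂ 0)
  have hK₃0 : 0 ≤ K₃ := (norm_nonneg _).trans (hK₃ 0)
  have hRR : 0 ≤ radialRowOneConst A (B.Dtmin - 2 * A) := radialRowOneConst_nonneg hA0 hDt
  have hC2 : 0 ≤ uRowTwoConst A A₃ (B.Dtmin - 2 * A) + 1 / (B.Dtmin - 2 * A) + 2 * (radialRowOneConst A (B.Dtmin - 2 * A) - 1 / (B.Dtmin - 2 * A)) := by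
    have := uRowTwoConst_nonneg hA0 hA₃0 hDt
    have := radialRowOneConst_sub_inv_nonneg hA0 hDt
    positivity
  -- the partner is a chart point on some sheet `m`
  obtain ⟨m, ψ, hP⟩ := exists_partner_pp_eq_levelPoint_add_period hA hd hlo hhi (ρ := ρ) (e := e) (ϑ := ϑ) (θ := θ) (φ := x) hē
  have hv : ∀ q : Momentum, frameLevel μ K (q + WithLp.toLp 2 (fun i => 2 * π * (m i : ℝ))) = frameLevel μ K q := frameLevel_add_twoPi μ K m
  -- the slope `ℓ` at the partner's own chart point is `< c₁`, the level gap `≤ κ`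
  have hℓ : |fderiv ℝ (frameLevel μ K) (levelPoint μ K (frameLevel μ K (pairSumPath μ K ρ ϑ θ 0 - levelPoint μ K e (x + θ))) ψ) (iteratedDeriv 1 (levelPoint μ K e) (x + θ))| < c₁ := by
    have h := deriv_partnerBand_pp_angle_eq_neg_sheet hA hd hlo hhi hv her hP
    rw [h, abs_neg] at hslope
    exact hslope
  have heps : |frameLevel μ K (pairSumPath μ K ρ ϑ θ 0 - levelPoint μ K e (x + θ)) - e| ≤ κ := hGe
  set τ0 := (π / 2 * c₁ / ((B.Dtmin - 2 * A) * B.umin) + π * Kc * κ / (B.Dtmin - 2 * A) ^ 2) / (B.umin * w / (4 + 2 * A)) with hτ0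
  have hτ : msD A₃ A₄ 1 *
        ((π / 2 * |fderiv ℝ (frameLevel μ K) (levelPoint μ K (frameLevel μ K (pairSumPath μ K ρ ϑ θ 0 - levelPoint μ K e (x + θ))) ψ) (iteratedDeriv 1 (levelPoint μ K e) (x + θ))| /
              ((B.Dtmin - 2 * A) * B.umin) + π * Kc * |frameLevel μ K (pairSumPath μ K ρ ϑ θ 0 - levelPoint μ K e (x + θ)) - e| / (B.Dtmin - 2 * A) ^ 2) / (B.umin * w / (4 + 2 * A))) ≤ msD A₃ A₄ 1 * τ0 := by
    refine mul_le_mul_of_nonneg_left (div_le_div_of_nonneg_right (add_le_add ?_ ?_) hcK.le) hM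
    · exact div_le_div_of_nonneg_right (mul_le_mul_of_nonneg_left hℓ.le (by positivity)) (by positivity)
    · exact div_le_div_of_nonneg_right (mul_le_mul_of_nonneg_left heps (by positivity)) (by positivity)
  rcases loopAlignment_dichotomy_sheet hA hA20 hd hlo hhi hA₃ hA₄ hG her hē her₀ hP with h | h
  · -- Cooper relative to the sheet `m`: excluded by `hC m`
    exfalso
    have hee' : |e - frameLevel μ K (pairSumPath μ K ρ ϑ θ 0 - levelPoint μ K e (x + θ))| ≤ κ := by rw [abs_sub_comm]; exact heps
    have h2 : |e - frameLevel μ K (pairSumPath μ K ρ ϑ θ 0 - levelPoint μ K e (x + θ))| / (B.Dtmin - 2 * A) ≤ κ / (B.Dtmin - 2 * A) := div_le_div_of_nonneg_right hee' hDt.le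
    have h3 := hC m
    linarith
  · -- near the caustic of the sheet `m`: the loop angle `x` is its own fold reference
    have hdist : ‖pairSumPath μ K ρ ϑ θ 0 - WithLp.toLp 2 (fun i => 2 * π * (m i : ℝ)) - (levelPoint μ K 0 (x + θ) + levelPoint μ K 0 (x + θ))‖ ≤
        msD A₃ A₄ 1 * τ0 + (2 * hi + κ) / (B.Dtmin - 2 * A) := by
      rw [← two_smul ℝ (levelPoint μ K 0 (x + θ))]
      have hsum : (|e| + |frameLevel μ K (pairSumPath μ K ρ ϑ θ 0 - levelPoint μ K e (x + θ))|) / (B.Dtmin - 2 * A) ≤ (2 * hi + κ) / (B.Dtmin - 2 * A) := by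
        refine div_le_div_of_nonneg_right ?_ hDt.le
        have h1 : |frameLevel μ K (pairSumPath μ K ρ ϑ θ 0 - levelPoint μ K e (x + θ))| ≤ |frameLevel μ K (pairSumPath μ K ρ ϑ θ 0 - levelPoint μ K e (x + θ)) - e| + |e| := by
          have := abs_add_le (frameLevel μ K (pairSumPath μ K ρ ϑ θ 0 - levelPoint μ K e (x + θ)) - e) e
          rwa [sub_add_cancel] at this
        linarith [h1, heps, hehi]
      linarith
    have hfloor := iteratedDeriv_two_partnerBand_pp_angle_ge_sheet hA hA20 hd hr' hlo hhi hA₃ hA₄ hK₁ hK₂ hK₃ hG (pairSumPath μ K ρ ϑ θ 0) m her θ x x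
    rw [sub_self, abs_zero, mul_zero, mul_zero, mul_zero, add_zero, add_zero, add_zero] at hfloor
    -- monotonicity of the modulus in the caustic distance and the level
    have hehi' : |e| ≤ hi := hehi
    set δ := msD A₃ A₄ 1 * τ0 + (2 * hi + κ) / (B.Dtmin - 2 * A) with hδ
    set dist := ‖pairSumPath μ K ρ ϑ θ 0 - WithLp.toLp 2 (fun i => 2 * π * (m i : ℝ)) - (levelPoint μ K 0 (x + θ) + levelPoint μ K 0 (x + θ))‖ with hdistdef
    have hq : dist + |e| / (B.Dtmin - 2 * A) ≤ δ + hi / (B.Dtmin - 2 * A) :=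
      add_le_add hdist (div_le_div_of_nonneg_right hehi' hDt.le)
    have t1 : K₃ * (dist + |e| / (B.Dtmin - 2 * A)) * msD A₃ A₄ 1 ^ 2 ≤ K₃ * (δ + hi / (B.Dtmin - 2 * A)) * msD A₃ A₄ 1 ^ 2 :=
      mul_le_mul_of_nonneg_right (mul_le_mul_of_nonneg_left hq hK₃0) (sq_nonneg _)
    have t2 : K₂ * (radialRowOneConst A (B.Dtmin - 2 * A) * |e|) * (msD A₃ A₄ 1 + msD A₃ A₄ 1) ≤
        K₂ * (radialRowOneConst A (B.Dtmin - 2 * A) * hi) * (msD A₃ A₄ 1 + msD A₃ A₄ 1) :=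
      mul_le_mul_of_nonneg_right (mul_le_mul_of_nonneg_left (mul_le_mul_of_nonneg_left hehi' hRR) hK₂0) (by positivity)
    have t3 : K₂ * (dist + |e| / (B.Dtmin - 2 * A)) * msD A₃ A₄ 2 ≤ K₂ * (δ + hi / (B.Dtmin - 2 * A)) * msD A₃ A₄ 2 :=
      mul_le_mul_of_nonneg_right (mul_le_mul_of_nonneg_left hq hK₂0) hM2
    have t4 : K₁ * ((uRowTwoConst A A₃ (B.Dtmin - 2 * A) + 1 / (B.Dtmin - 2 * A) +
          2 * (radialRowOneConst A (B.Dtmin - 2 * A) - 1 / (B.Dtmin - 2 * A))) * |e|) ≤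
        K₁ * ((uRowTwoConst A A₃ (B.Dtmin - 2 * A) + 1 / (B.Dtmin - 2 * A) +
          2 * (radialRowOneConst A (B.Dtmin - 2 * A) - 1 / (B.Dtmin - 2 * A))) * hi) :=
      mul_le_mul_of_nonneg_left (mul_le_mul_of_nonneg_left hehi' hC2) hK₁0
    linarith


omit hr in
/-- **THE NON-COOPER LEVEL-LOOP COUNT FOR NEGATIVE LOOP LEVELS** (see the module docstring): p652943's `level_loop_partnerBand_le_nonCooper` for the reflected family
`e ↦ Φ(−e, ·)` — same hypotheses (`0 < lo ≤ e ≤ hi`, not Cooper at scale `(c₁, κ)`, smallness), same bound; the loop level of the integrand is `−e`. -/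
theorem level_loop_partnerBand_le_nonCooper_neg {Kc r₀ g₀ w : ℝ} (hG : GeomConstants (frameLevel μ K) Kc r₀ g₀ w) (hK₁0 : 0 < K₁)
    {ρ ϑ θ a b lo hi κ c₁ W : ℝ} {t wt : ℝ → ℝ} {N : ℕ}
    (hab : a ≤ b) (hlo0 : 0 < lo) (hlohi : lo ≤ hi) (hhir₀ : hi < r₀) (hhir : hi + κ < r) (hκ : 0 < κ) (hc₁ : 0 < c₁)
    (hC : ∀ m : Fin 2 → ℤ, msD A₃ A₄ 1 *
            ((π / 2 * c₁ /
                  (((bandBounds (show (-4 : ℝ) < -1.1 by norm_num) (show (-1.1 : ℝ) ≤ -0.1 by norm_num) (show (-0.1 : ℝ) < 0 by norm_num)).Dtmin -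
                      2 * A) *
                    (bandBounds (show (-4 : ℝ) < -1.1 by norm_num) (show (-1.1 : ℝ) ≤ -0.1 by norm_num) (show (-0.1 : ℝ) < 0 by norm_num)).umin) +
                π * Kc * κ / ((bandBounds (show (-4 : ℝ) < -1.1 by norm_num) (show (-1.1 : ℝ) ≤ -0.1 by norm_num) (show (-0.1 : ℝ) < 0 by norm_num)).Dtmin - 2 * A) ^ 2) /
              ((bandBounds (show (-4 : ℝ) < -1.1 by norm_num) (show (-1.1 : ℝ) ≤ -0.1 by norm_num) (show (-0.1 : ℝ) < 0 by norm_num)).umin * w /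
                (4 + 2 * A))) +
          κ / ((bandBounds (show (-4 : ℝ) < -1.1 by norm_num) (show (-1.1 : ℝ) ≤ -0.1 by norm_num) (show (-0.1 : ℝ) < 0 by norm_num)).Dtmin - 2 * A) <
        ‖pairSumPath μ K ρ ϑ θ 0 - WithLp.toLp 2 (fun i => 2 * π * (m i : ℝ))‖)
    (hsmall :
        K₃ * ((msD A₃ A₄ 1 *
            ((π / 2 * c₁ /
                  (((bandBounds (show (-4 : ℝ) < -1.1 by norm_num) (show (-1.1 : ℝ) ≤ -0.1 by norm_num) (show (-0.1 : ℝ) < 0 by norm_num)).Dtmin -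
                      2 * A) *
                    (bandBounds (show (-4 : ℝ) < -1.1 by norm_num) (show (-1.1 : ℝ) ≤ -0.1 by norm_num) (show (-0.1 : ℝ) < 0 by norm_num)).umin) +
                π * Kc * κ / ((bandBounds (show (-4 : ℝ) < -1.1 by norm_num) (show (-1.1 : ℝ) ≤ -0.1 by norm_num) (show (-0.1 : ℝ) < 0 by norm_num)).Dtmin - 2 * A) ^ 2) /
              ((bandBounds (show (-4 : ℝ) < -1.1 by norm_num) (show (-1.1 : ℝ) ≤ -0.1 by norm_num) (show (-0.1 : ℝ) < 0 by norm_num)).umin * w /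
                (4 + 2 * A)))) +
          (2 * hi + κ) / ((bandBounds (show (-4 : ℝ) < -1.1 by norm_num) (show (-1.1 : ℝ) ≤ -0.1 by norm_num) (show (-0.1 : ℝ) < 0 by norm_num)).Dtmin - 2 * A) +
              hi / ((bandBounds (show (-4 : ℝ) < -1.1 by norm_num) (show (-1.1 : ℝ) ≤ -0.1 by norm_num) (show (-0.1 : ℝ) < 0 by norm_num)).Dtmin - 2 * A)) *
            msD A₃ A₄ 1 ^ 2 +
          K₂ * (radialRowOneConst A ((bandBounds (show (-4 : ℝ) < -1.1 by norm_num) (show (-1.1 : ℝ) ≤ -0.1 by norm_num) (show (-0.1 : ℝ) < 0 by norm_num)).Dtmin -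
                2 * A) * hi) * (msD A₃ A₄ 1 + msD A₃ A₄ 1) +
          K₂ * ((msD A₃ A₄ 1 *
            ((π / 2 * c₁ /
                  (((bandBounds (show (-4 : ℝ) < -1.1 by norm_num) (show (-1.1 : ℝ) ≤ -0.1 by norm_num) (show (-0.1 : ℝ) < 0 by norm_num)).Dtmin -
                      2 * A) *
                    (bandBounds (show (-4 : ℝ) < -1.1 by norm_num) (show (-1.1 : ℝ) ≤ -0.1 by norm_num) (show (-0.1 : ℝ) < 0 by norm_num)).umin) +
                π * Kc * κ / ((bandBounds (show (-4 : ℝ) < -1.1 by norm_num) (show (-1.1 : ℝ) ≤ -0.1 by norm_num) (show (-0.1 : ℝ) < 0 by norm_num)).Dtmin - 2 * A) ^ 2) /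
              ((bandBounds (show (-4 : ℝ) < -1.1 by norm_num) (show (-1.1 : ℝ) ≤ -0.1 by norm_num) (show (-0.1 : ℝ) < 0 by norm_num)).umin * w /
                (4 + 2 * A)))) +
          (2 * hi + κ) / ((bandBounds (show (-4 : ℝ) < -1.1 by norm_num) (show (-1.1 : ℝ) ≤ -0.1 by norm_num) (show (-0.1 : ℝ) < 0 by norm_num)).Dtmin - 2 * A) +
              hi / ((bandBounds (show (-4 : ℝ) < -1.1 by norm_num) (show (-1.1 : ℝ) ≤ -0.1 by norm_num) (show (-0.1 : ℝ) < 0 by norm_num)).Dtmin - 2 * A)) *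
            msD A₃ A₄ 2 +
          K₁ * ((uRowTwoConst A A₃ ((bandBounds (show (-4 : ℝ) < -1.1 by norm_num) (show (-1.1 : ℝ) ≤ -0.1 by norm_num) (show (-0.1 : ℝ) < 0 by norm_num)).Dtmin -
                  2 * A) +
                1 / ((bandBounds (show (-4 : ℝ) < -1.1 by norm_num) (show (-1.1 : ℝ) ≤ -0.1 by norm_num) (show (-0.1 : ℝ) < 0 by norm_num)).Dtmin - 2 * A) +
                2 * (radialRowOneConst A ((bandBounds (show (-4 : ℝ) < -1.1 by norm_num) (show (-1.1 : ℝ) ≤ -0.1 by norm_num) (show (-0.1 : ℝ) < 0 by norm_num)).Dtmin - 2 * A) -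
                  1 / ((bandBounds (show (-4 : ℝ) < -1.1 by norm_num) (show (-1.1 : ℝ) ≤ -0.1 by norm_num) (show (-0.1 : ℝ) < 0 by norm_num)).Dtmin - 2 * A))) *
              hi) ≤
        w * (bandBounds (show (-4 : ℝ) < -1.1 by norm_num) (show (-1.1 : ℝ) ≤ -0.1 by norm_num) (show (-0.1 : ℝ) < 0 by norm_num)).umin ^ 2)
    (hN : (b - a) * (4 * (K₁ * msD A₃ A₄ 1)) ≤ N * κ) (hN' : (b - a) * (4 * (K₂ * msD A₃ A₄ 1 ^ 2 + K₁ * msD A₃ A₄ 2)) ≤ N * c₁)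
    (ht : ∀ e ∈ Icc lo hi, e ≤ t e) (hW : 0 ≤ W) (hw0 : ∀ e ∈ Icc lo hi, 0 ≤ wt e) (hw : ∀ e ∈ Icc lo hi, wt e ≤ W) :
    ∫ e in lo..hi, wt e * ∫ x in Icc a b, (max (t e) |frameLevel μ K (pairSumPath μ K ρ ϑ θ 0 - levelPoint μ K (-e) (x + θ))|)⁻¹ ≤
      W * ((4 * (b - a) / κ + 2 * (N * (4 / c₁))) * (κ / 2) +
        2 * (12 * N / Real.sqrt (w * (bandBounds (show (-4 : ℝ) < -1.1 by norm_num) (show (-1.1 : ℝ) ≤ -0.1 by norm_num) (show (-0.1 : ℝ) < 0 by norm_num)).umin ^ 2)) * Real.sqrt (κ / 2) + (b - a) * log⁺ (hi / (κ / 2))) := by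
  have hM := msD_one_pos A₃ A₄
  have hM2 := msD_two_pos A₃ A₄
  have hupos := (bandBounds (show (-4 : ℝ) < -1.1 by norm_num) (show (-1.1 : ℝ) ≤ -0.1 by norm_num) (show (-0.1 : ℝ) < 0 by norm_num)).umin_pos
  have hwpos := hG.wmin_pos
  have hK₂0 : 0 ≤ K₂ := (norm_nonneg _).trans (hK₂ 0)
  have hc₂ : 0 < w * (bandBounds (show (-4 : ℝ) < -1.1 by norm_num) (show (-1.1 : ℝ) ≤ -0.1 by norm_num) (show (-0.1 : ℝ) < 0 by norm_num)).umin ^ 2 := by positivity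
  have hL₂ : 0 < K₂ * msD A₃ A₄ 1 ^ 2 + K₁ * msD A₃ A₄ 2 := by positivity
  have heI : ∀ e ∈ Icc lo hi, |(-e)| < r ∧ |(-e)| ≤ hi := fun e he => by
    have h0 : 0 < e := hlo0.trans_le he.1
    rw [abs_neg, abs_of_pos h0]
    exact ⟨by linarith [he.2, hκ], he.2⟩
  -- the abstract layer for the reflected family `G e x := −ē(−e, x)` (near-nesting gap `|G e x − e| = |ē − (−e)|`)
  have h := level_loop_inv_envelope_le_of_rel_dichotomy_two (G := fun e x => -frameLevel μ K (pairSumPath μ K ρ ϑ θ 0 - levelPoint μ K (-e) (x + θ)))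
    (t := t) (w := wt) hab hlo0 hlohi (fun e he => (contDiff_partnerBand_pp_angle hA hd hlo hhi ρ (heI e he).1 ϑ θ 2).neg) hκ hc₁ hc₂ (mul_pos hK₁0 hM) hL₂
    (fun e he x _ => by
      rw [deriv.fun_neg, abs_neg]; exact abs_deriv_partnerBand_pp_angle_le hA hA20 hd hlo hhi hA₃ hA₄ hK₁ ρ (heI e he).1 ϑ θ x)
    (fun e he x _ => by
      rw [iteratedDeriv_fun_neg, abs_neg]
      exact abs_iteratedDeriv_two_partnerBand_pp_angle_le hA hA20 hd hlo hhi hA₃ hA₄ hK₁ hK₂ (pairSumPath μ K ρ ϑ θ 0) (heI e he).1 θ x)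
    (fun e he x _ hGe hsl => by
      rw [iteratedDeriv_fun_neg, abs_neg]
      have hGe' : |frameLevel μ K (pairSumPath μ K ρ ϑ θ 0 - levelPoint μ K (-e) (x + θ)) - (-e)| ≤ κ := by
        rw [show frameLevel μ K (pairSumPath μ K ρ ϑ θ 0 - levelPoint μ K (-e) (x + θ)) - (-e) =
          -(-frameLevel μ K (pairSumPath μ K ρ ϑ θ 0 - levelPoint μ K (-e) (x + θ)) - e) by ring, abs_neg]; exact hGe
      have hsl' : |deriv (fun y : ℝ => frameLevel μ K (pairSumPath μ K ρ ϑ θ 0 - levelPoint μ K (-e) (y + θ))) x| < c₁ := by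
        rw [deriv.fun_neg, abs_neg] at hsl; exact hsl
      have hd2 := rel_dichotomy_two_partnerBand_abs hA hA20 hd hlo hhi hA₃ hA₄ hK₁ hK₂ hK₃ hG (heI e he).2 hhir₀ hhir hκ.le hC hsmall x hGe' hsl'
      exact hd2.trans (le_abs_self _))
    hN hN' ht hW hw0 hw
  -- `|−ē| = |ē|` inside the envelope
  refine le_of_eq_of_le ?_ h
  refine intervalIntegral.integral_congr fun e _ => ?_
  simp only [abs_neg]

omit hr hK₁ hK₃ in
/-- **THE COOPER-CHORD LEVEL-LOOP COUNT FOR NEGATIVE LOOP LEVELS** (see the module docstring): p651940's `level_loop_partnerBand_le_cooper_chord` for the reflected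
family `e ↦ Φ(−e, ·)` — same hypotheses, same bound; the loop level of the integrand is `−e`. -/
theorem level_loop_partnerBand_le_cooper_chord_neg {Kc r₀ g₀ w : ℝ} (hG : GeomConstants (frameLevel μ K) Kc r₀ g₀ w) (hK₂0 : 0 < K₂)
    {ρ ϑ θ a' b' lo hi c₀ c₁ W : ℝ} {t wt : ℝ → ℝ} {N : ℕ}
    (hab : a' ≤ b') (hlo0 : 0 < lo) (hlohi : lo ≤ hi) (hhir₀ : hi < r₀) (hhir : hi + c₀ * ‖pairSumPath μ K ρ ϑ θ 0‖ < r)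
    (hc₀ : 0 < c₀) (hc₁ : 0 < c₁) (hs : 0 < ‖pairSumPath μ K ρ ϑ θ 0‖)
    (hX : msD A₃ A₄ 1 *
            ((π / 2 * c₁ /
                  (((bandBounds (show (-4 : ℝ) < -1.1 by norm_num) (show (-1.1 : ℝ) ≤ -0.1 by norm_num) (show (-0.1 : ℝ) < 0 by norm_num)).Dtmin -
                      2 * A) *
                    (bandBounds (show (-4 : ℝ) < -1.1 by norm_num) (show (-1.1 : ℝ) ≤ -0.1 by norm_num) (show (-0.1 : ℝ) < 0 by norm_num)).umin) +
                π * Kc * c₀ / ((bandBounds (show (-4 : ℝ) < -1.1 by norm_num) (show (-1.1 : ℝ) ≤ -0.1 by norm_num)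
                  (show (-0.1 : ℝ) < 0 by norm_num)).Dtmin - 2 * A) ^ 2) /
              ((bandBounds (show (-4 : ℝ) < -1.1 by norm_num) (show (-1.1 : ℝ) ≤ -0.1 by norm_num) (show (-0.1 : ℝ) < 0 by norm_num)).umin * w /
                (4 + 2 * A))) +
          c₀ / ((bandBounds (show (-4 : ℝ) < -1.1 by norm_num) (show (-1.1 : ℝ) ≤ -0.1 by norm_num) (show (-0.1 : ℝ) < 0 by norm_num)).Dtmin - 2 * A) < 1)
    (hwin : ‖pairSumPath μ K ρ ϑ θ 0‖ * (msD A₃ A₄ 1 *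
            ((π / 2 * c₁ /
                  (((bandBounds (show (-4 : ℝ) < -1.1 by norm_num) (show (-1.1 : ℝ) ≤ -0.1 by norm_num) (show (-0.1 : ℝ) < 0 by norm_num)).Dtmin -
                      2 * A) *
                    (bandBounds (show (-4 : ℝ) < -1.1 by norm_num) (show (-1.1 : ℝ) ≤ -0.1 by norm_num) (show (-0.1 : ℝ) < 0 by norm_num)).umin) +
                π * Kc * c₀ / ((bandBounds (show (-4 : ℝ) < -1.1 by norm_num) (show (-1.1 : ℝ) ≤ -0.1 by norm_num)
                  (show (-0.1 : ℝ) < 0 by norm_num)).Dtmin - 2 * A) ^ 2) /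
              ((bandBounds (show (-4 : ℝ) < -1.1 by norm_num) (show (-1.1 : ℝ) ≤ -0.1 by norm_num) (show (-0.1 : ℝ) < 0 by norm_num)).umin * w /
                (4 + 2 * A))) +
          c₀ / ((bandBounds (show (-4 : ℝ) < -1.1 by norm_num) (show (-1.1 : ℝ) ≤ -0.1 by norm_num) (show (-0.1 : ℝ) < 0 by norm_num)).Dtmin - 2 * A)) +
          2 * hi / ((bandBounds (show (-4 : ℝ) < -1.1 by norm_num) (show (-1.1 : ℝ) ≤ -0.1 by norm_num) (show (-0.1 : ℝ) < 0 by norm_num)).Dtmin - 2 * A) +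
          ‖pairSumPath μ K ρ ϑ θ 0‖ < 3 / 5)
    (hwin' : ‖pairSumPath μ K ρ ϑ θ 0‖ * (msD A₃ A₄ 1 *
            ((π / 2 * c₁ /
                  (((bandBounds (show (-4 : ℝ) < -1.1 by norm_num) (show (-1.1 : ℝ) ≤ -0.1 by norm_num) (show (-0.1 : ℝ) < 0 by norm_num)).Dtmin -
                      2 * A) *
                    (bandBounds (show (-4 : ℝ) < -1.1 by norm_num) (show (-1.1 : ℝ) ≤ -0.1 by norm_num) (show (-0.1 : ℝ) < 0 by norm_num)).umin) +
                π * Kc * c₀ / ((bandBounds (show (-4 : ℝ) < -1.1 by norm_num) (show (-1.1 : ℝ) ≤ -0.1 by norm_num)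
                  (show (-0.1 : ℝ) < 0 by norm_num)).Dtmin - 2 * A) ^ 2) /
              ((bandBounds (show (-4 : ℝ) < -1.1 by norm_num) (show (-1.1 : ℝ) ≤ -0.1 by norm_num) (show (-0.1 : ℝ) < 0 by norm_num)).umin * w /
                (4 + 2 * A))) +
          c₀ / ((bandBounds (show (-4 : ℝ) < -1.1 by norm_num) (show (-1.1 : ℝ) ≤ -0.1 by norm_num) (show (-0.1 : ℝ) < 0 by norm_num)).Dtmin - 2 * A)) +
          2 * hi / ((bandBounds (show (-4 : ℝ) < -1.1 by norm_num) (show (-1.1 : ℝ) ≤ -0.1 by norm_num) (show (-0.1 : ℝ) < 0 by norm_num)).Dtmin - 2 * A) +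
          ‖pairSumPath μ K ρ ϑ θ 0‖ <
        2 * (bandBounds (show (-4 : ℝ) < -1.1 by norm_num) (show (-1.1 : ℝ) ≤ -0.1 by norm_num) (show (-0.1 : ℝ) < 0 by norm_num)).umin)
    (hN : (b' - a') * (4 * (K₂ * msD A₃ A₄ 1)) ≤ N * c₀)
    (ht : ∀ e ∈ Icc lo hi, e ≤ t e) (hW : 0 ≤ W) (hw0 : ∀ e ∈ Icc lo hi, 0 ≤ wt e) (hw : ∀ e ∈ Icc lo hi, wt e ≤ W) :
    ∫ e in lo..hi, wt e * ∫ x in Icc a' b', (max (t e) |frameLevel μ K (pairSumPath μ K ρ ϑ θ 0 - levelPoint μ K (-e) (x + θ))|)⁻¹ ≤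
      W * (2 * (b' - a') + 2 * (N * c₀ / c₁) + (b' - a') * log⁺ (hi / (c₀ * ‖pairSumPath μ K ρ ϑ θ 0‖ / 2))) := by
  set B := (bandBounds (show (-4 : ℝ) < -1.1 by norm_num) (show (-1.1 : ℝ) ≤ -0.1 by norm_num) (show (-0.1 : ℝ) < 0 by norm_num)) with hBdef
  have hDt : 0 < B.Dtmin - 2 * A := by have := klCurveD_pos; linarith
  have hM := msD_one_pos A₃ A₄
  have heI : ∀ e ∈ Icc lo hi, |(-e)| < r ∧ |(-e)| < r₀ ∧ |(-e)| ≤ hi := fun e he => by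
    have h0 : 0 < e := hlo0.trans_le he.1
    rw [abs_neg, abs_of_pos h0]
    have : 0 ≤ c₀ * ‖pairSumPath μ K ρ ϑ θ 0‖ := by positivity
    exact ⟨by linarith [he.2], by linarith [he.2], he.2⟩
  have h := level_loop_inv_envelope_le_cooper (G := fun e x => -frameLevel μ K (pairSumPath μ K ρ ϑ θ 0 - levelPoint μ K (-e) (x + θ)))
    (t := t) (w := wt) hab hlo0 hlohi (fun e he => (contDiff_partnerBand_pp_angle hA hd hlo hhi ρ (heI e he).1 ϑ θ 1).neg) (η := ‖pairSumPath μ K ρ ϑ θ 0‖) hs hc₀ hc₁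
    (mul_pos hK₂0 hM) (fun e he x _ => ?_) (fun e he x _ hGe => ?_) hN ht hW hw0 hw
  · refine le_of_eq_of_le ?_ h
    refine intervalIntegral.integral_congr fun e _ => ?_
    simp only [abs_neg]
  · rw [deriv.fun_neg, abs_neg]
    have h := abs_deriv_partnerBand_pp_angle_le_chord hA hA20 hd hlo hhi hA₃ hA₄ hK₂ ρ (heI e he).1 ϑ θ x
    calc _ ≤ K₂ * ‖pairSumPath μ K ρ ϑ θ 0‖ * msD A₃ A₄ 1 := h
      _ = K₂ * msD A₃ A₄ 1 * ‖pairSumPath μ K ρ ϑ θ 0‖ := by ring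
  · obtain ⟨her, her₀, hehi⟩ := heI e he
    rw [deriv.fun_neg, abs_neg]
    have hGe' : |frameLevel μ K (pairSumPath μ K ρ ϑ θ 0 - levelPoint μ K (-e) (x + θ)) - (-e)| ≤ c₀ * ‖pairSumPath μ K ρ ϑ θ 0‖ := by
      rw [show frameLevel μ K (pairSumPath μ K ρ ϑ θ 0 - levelPoint μ K (-e) (x + θ)) - (-e) =
        -(-frameLevel μ K (pairSumPath μ K ρ ϑ θ 0 - levelPoint μ K (-e) (x + θ)) - e) by ring, abs_neg]; exact hGe
    have hē : |frameLevel μ K (pairSumPath μ K ρ ϑ θ 0 - levelPoint μ K (-e) (x + θ))| < r := by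
      have h1 := abs_sub_abs_le_abs_sub (frameLevel μ K (pairSumPath μ K ρ ϑ θ 0 - levelPoint μ K (-e) (x + θ))) (-e)
      have h2 : |frameLevel μ K (pairSumPath μ K ρ ϑ θ 0 - levelPoint μ K (-e) (x + θ))| ≤ c₀ * ‖pairSumPath μ K ρ ϑ θ 0‖ + |(-e)| := by
        linarith [h1, hGe']
      have h3 : |(-e)| ≤ hi := hehi
      linarith [h2, h3, hhir]
    refine (abs_deriv_partnerBand_pp_angle_gt_cooper_chord hA hA20 hd hlo hhi hA₃ hA₄ hG her her₀ hē hs hGe' hX ?_ ?_).le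
    · have hmono : 2 * |(-e)| / (B.Dtmin - 2 * A) ≤ 2 * hi / (B.Dtmin - 2 * A) :=
        div_le_div_of_nonneg_right (by linarith [hehi]) hDt.le
      linarith
    · have hmono : 2 * |(-e)| / (B.Dtmin - 2 * A) ≤ 2 * hi / (B.Dtmin - 2 * A) :=
        div_le_div_of_nonneg_right (by linarith [hehi]) hDt.le
      linarith

end Sizes

end Summit.HubbardSuperconductivity.HubbardSuperconductivity.Theorems.C4a

end
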